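import Mathlib

/-!
# Solo-blind seat (MatrixMultiplication), s78 — the halved Kraft inequality (E) is tight with representations of MIXED sizes
(paper/KraftK3.md §7.21, K3.21.13; CLAIMS c834)

Background (door I1⁗, the Kraft inequality (K₃) for zero-sum-free sequences over `𝔽₃`).  For `h : [n] → 𝔽₃^r` and a target `τ`
write `F(τ)` for the set of index sets `T` with `∑_{i ∈ T} h i = τ` and `K(τ) = ∑_{T ∈ F(τ)} 2^{-|T|}`.  The extension inequality (E)
(KraftK3 §1 (i″), the diagonal case of (K₃)) asserts `K(τ) ≤ 1/2` whenever the EXTENDED sequence `h, τ` is zero-sum free.  Session s78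
proved its weight-4 truncation in all ranks by a finite census (`N₄ + 2N₃ + 4N₂ + 8N₁ ≤ 8`, c834) and found that the bound is attained at
EVERY composition `8 = N₄ + 2N₃ + 4N₂ + 8N₁` — the size multisets of the tight fibres are exactly the leaf-depth multisets of binary trees.

This file certifies in the kernel the smallest tight instance with three different sizes (profile `(N₄,N₃,N₂,N₁) = (2,1,1,0)`, leaf depths
`2,3,4,4`): for the explicit `soloBlindEMix_h : Fin 7 → 𝔽₃⁴` and `τ = (1,2,1,1)`
* the extended sequence `h, τ` (length 8) is zero-sum free (`soloBlindEMix_ext_zsf`, all `2^8` subsets);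
* the fibre of `τ` is EXACTLY `{{0,3}, {0,1,2}, {0,2,4,6}, {1,3,4,5}}` (`soloBlindEMix_fibre_spec`, all `2^7` subsets), of sizes `2,3,4,4`;
* the scaled Kraft sum is `∑_{T ∈ F(τ)} 2^(7-|T|) = 32+16+8+8 = 2^6`, i.e. `K(τ) = 1/4+1/8+1/16+1/16 = 1/2` exactly (`soloBlindEMix_kraft`).
So (E) cannot be sharpened by any inequality that penalises mixed sizes (e.g. `N₄ + 2N₃ + 4N₂ < 8` when two sizes occur is false).
Pure finite combinatorics (`decide +kernel`); no `ω` content.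
-/

set_option linter.dupNamespace false
set_option autoImplicit false

namespace Summit.MatrixMultiplication.MatrixMultiplication.Theorems

open Finset BigOperators

/-- The group `𝔽₃⁴`, as a nested product (computation-friendly for `decide`). -/
abbrev SoloBlindEMixG4 : Type := ZMod 3 × ZMod 3 × ZMod 3 × ZMod 3

/-- The explicit sequence of length 7 in `𝔽₃⁴`: `(0,2,1,1), (0,1,0,1), (1,2,0,2), e₁, e₂, e₃, e₄`. -/
def soloBlindEMix_h : Fin 7 → SoloBlindEMixG4 :=
  ![(0, 2, 1, 1), (0, 1, 0, 1), (1, 2, 0, 2), (1, 0, 0, 0), (0, 1, 0, 0), (0, 0, 1, 0), (0, 0, 0, 1)]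

/-- The target `τ = (1,2,1,1)`. -/
def soloBlindEMix_tau : SoloBlindEMixG4 := (1, 2, 1, 1)

/-- The extended sequence `h, τ` of length 8 (the hypothesis of (E) is that THIS sequence is zero-sum free). -/
def soloBlindEMix_ext : Fin 8 → SoloBlindEMixG4 :=
  ![(0, 2, 1, 1), (0, 1, 0, 1), (1, 2, 0, 2), (1, 0, 0, 0), (0, 1, 0, 0), (0, 0, 1, 0), (0, 0, 0, 1), (1, 2, 1, 1)]

/-- The fibre of `τ`: four index sets of sizes `2, 3, 4, 4`. -/
def soloBlindEMix_fibre : Finset (Finset (Fin 7)) :=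
  {{0, 3}, {0, 1, 2}, {0, 2, 4, 6}, {1, 3, 4, 5}}

/-- The extended sequence agrees with `h` on the first 7 terms and has `τ` as its last term. -/
theorem soloBlindEMix_ext_spec : (∀ i : Fin 7, soloBlindEMix_ext (Fin.castSucc i) = soloBlindEMix_h i) ∧
    soloBlindEMix_ext (Fin.last 7) = soloBlindEMix_tau := by
  decide +kernel

set_option maxHeartbeats 0 in
/-- THE HYPOTHESIS OF (E): the extended sequence `h, τ` is zero-sum free (all `2^8` subsets, in the kernel). -/
theorem soloBlindEMix_ext_zsf : ∀ T : Finset (Fin 8), ∑ i ∈ T, soloBlindEMix_ext i = 0 → T = ∅ := by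
  decide +kernel

set_option maxHeartbeats 0 in
/-- THE FIBRE OF `τ` is exactly `soloBlindEMix_fibre` (all `2^7` subsets, in the kernel). -/
theorem soloBlindEMix_fibre_spec : ∀ T : Finset (Fin 7),
    (∑ i ∈ T, soloBlindEMix_h i = soloBlindEMix_tau) ↔ T ∈ soloBlindEMix_fibre := by
  decide +kernel

/-- MIXED SIZES: four representations, of sizes `2, 3, 4, 4` (`N₂ = 1, N₃ = 1, N₄ = 2`, nothing else). -/
theorem soloBlindEMix_fibre_sizes : soloBlindEMix_fibre.card = 4 ∧
    (soloBlindEMix_fibre.filter (fun T => T.card = 2)).card = 1 ∧ (soloBlindEMix_fibre.filter (fun T => T.card = 3)).card = 1 ∧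
    (soloBlindEMix_fibre.filter (fun T => T.card = 4)).card = 2 ∧ (∀ T ∈ soloBlindEMix_fibre, 2 ≤ T.card ∧ T.card ≤ 4) := by
  decide +kernel

/-- KRAFT SUM EXACTLY ONE HALF: `∑_{T ∈ F(τ)} 2^(7 - |T|) = 2^6`, i.e. `K(τ) = 1/4 + 1/8 + 1/16 + 1/16 = 1/2`; (E) is tight at the
mixed profile `N₄ + 2N₃ + 4N₂ = 2 + 2 + 4 = 8`. -/
theorem soloBlindEMix_kraft : ∑ T ∈ soloBlindEMix_fibre, 2 ^ (7 - T.card) = 2 ^ 6 := by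
  decide +kernel

/-- SUMMARY (tightness of (E) with mixed sizes): there is a zero-sum-free `g : Fin 8 → 𝔽₃⁴` such that the subsets of its first 7
indices summing to the 8th term are exactly four sets of sizes `2,3,4,4`, with scaled Kraft sum `2^6` (= one half of `2^7`). -/
theorem soloBlind_E_tight_mixed :
    (∀ T : Finset (Fin 8), ∑ i ∈ T, soloBlindEMix_ext i = 0 → T = ∅) ∧
    (∀ T : Finset (Fin 7), (∑ i ∈ T, soloBlindEMix_ext (Fin.castSucc i) = soloBlindEMix_ext (Fin.last 7)) ↔ T ∈ soloBlindEMix_fibre) ∧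
    soloBlindEMix_fibre.card = 4 ∧ (∑ T ∈ soloBlindEMix_fibre, 2 ^ (7 - T.card) = 2 ^ 6) := by
  refine ⟨soloBlindEMix_ext_zsf, ?_, soloBlindEMix_fibre_sizes.1, soloBlindEMix_kraft⟩
  intro T
  have h1 : ∀ i : Fin 7, soloBlindEMix_ext (Fin.castSucc i) = soloBlindEMix_h i := soloBlindEMix_ext_spec.1
  have h2 : soloBlindEMix_ext (Fin.last 7) = soloBlindEMix_tau := soloBlindEMix_ext_spec.2
  simp only [h1, h2]
  exact soloBlindEMix_fibre_spec T

end Summit.MatrixMultiplication.MatrixMultiplication.Theorems
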